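import Mathlib
import Summits.ValiantsHypothesis.ValiantsHypothesis.Theses.DivisionGap
import Summits.ValiantsHypothesis.ValiantsHypothesis.Theorems.DivisionGapShadowBirkhoffPolytropeDefs
import Summits.ValiantsHypothesis.ValiantsHypothesis.Theorems.DivisionGapShadowBirkhoffStubFaceShadow

/-!
# Sketch — crux idea `tension-matching-shadow` (crux-ideate r2 k5, stmt-ValiantsHypothesis-5069)

First-lemma signatures for the card "tension polytopes as matching shadows":
the crux `ShadowBirkhoff` follows from
  (A) `StCutShadowExp`  — a STABLE-SET polytope of a BIPARTITE graph of size poly(n) (namely the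
      s–t closure/cut polytope `R_st(H_n)` of a Murty–Carstensen max-flow network, `≅ STAB` of the
      vertex–edge incidence graph of `H_n` minus `s`, `N[t]`) has a planar shadow with `2^{Ω(n)}`
      vertices  [Murty 1980; Carstensen 1983; Mulmuley 1999; printed as Pellissier–Seiller Thm 37:
      parametric max-flow has complexity 2^{Ω(n)} with bitsize O(n²)] — to be VENDORED as a
      Literature fact; and
  (B) `StabPresentation` — every stable-set polytope of a bipartite graph on `k` vertices is the
      linear image of a pattern face of a Birkhoff polytope `DS_N` with `N ≤ 2^{(log₂ k + d)^d}`
      (quasi-polynomial size suffices!) — the NEW lever (co-network TU polytopes as images of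
      network/matching polytopes; Grochow 2017: = Newton polytopes of monotone p-projections of per).
Glue uses the landed `stub_faceShadow` (pattern face ≤ 4·σ(DS_N)) and `stub_facePad`.
-/

noncomputable section

namespace Summit.ValiantsHypothesis.ValiantsHypothesis.Cruxes.ShadowBirkhoff.Ideator5

open Summit.ValiantsHypothesis.ValiantsHypothesis.Theorems.DivisionGapShadowBirkhoff
  (patternPoints patternShadowVertexCount)

/-- `S` is a stable set of the graph on `Fin k` with (symmetric) edge set `E`. -/
def IsStable {k : ℕ} (E : Finset (Fin k × Fin k)) (S : Finset (Fin k)) : Prop :=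
  ∀ i ∈ S, ∀ j ∈ S, (i, j) ∉ E

/-- The graph `E` on `Fin k` is bipartite (2-colourable, edges read symmetrically). -/
def IsBipartiteEdgeSet {k : ℕ} (E : Finset (Fin k × Fin k)) : Prop :=
  ∃ side : Fin k → Bool, ∀ p ∈ E, side p.1 ≠ side p.2

/-- Indicator vectors of the stable sets: the vertex set of `STAB(E)`. -/
def stabPoints (k : ℕ) (E : Finset (Fin k × Fin k)) : Set (Fin k → ℝ) :=
  {x | ∃ S : Finset (Fin k), IsStable E S ∧ x = fun i => if i ∈ S then 1 else 0}

/-- (B) THE LEVER.  Stable-set polytopes of bipartite graphs are linear images of Birkhoff faces of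
quasi-polynomial size: for some `d`, every bipartite `E` on `Fin k` admits `N ≤ 2^{(log₂ k + d)^d}`,
a pattern `Z ⊆ Fin N × Fin N` and a linear `π` with `π(patternPoints) ⊆ conv(stabPoints)` and
`stabPoints ⊆ π(patternPoints)` (i.e. `conv π(face) = STAB(E)`). -/
def StabPresentation : Prop :=
  ∃ d : ℕ, ∀ (k : ℕ) (E : Finset (Fin k × Fin k)), IsBipartiteEdgeSet E →
    ∃ N : ℕ, N ≤ 2 ^ ((Nat.log 2 k + d) ^ d) ∧
      ∃ (Z : Set (Fin N × Fin N)) (π : (Fin N × Fin N → ℝ) →ₗ[ℝ] (Fin k → ℝ)),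
        π '' patternPoints N Z ⊆ convexHull ℝ (stabPoints k E) ∧
          stabPoints k E ⊆ π '' patternPoints N Z

/-- (A) THE IMPORTED SOURCE (to be vendored; Murty 1980 / Carstensen 1983 / Mulmuley 1999):
for some `C > 0` and all large `n` there is a bipartite graph on `k ≤ n³` vertices and a planar
projection of its stable-set polytope with more than `2^{n/C}` vertices (the parametric s–t min-cut
function of an `n`-node network with capacities affine in `λ` has `2^{Ω(n)}` break points, and its
closure polytope is such a `STAB`). -/
def StCutShadowExp : Prop :=
  ∃ C : ℕ, 0 < C ∧ ∀ n ≥ C, ∃ k ≤ n ^ 3, ∃ (E : Finset (Fin k × Fin k)),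
    IsBipartiteEdgeSet E ∧ ∃ L : (Fin k → ℝ) →ₗ[ℝ] (Fin 2 → ℝ),
      2 ^ (n / C) < (Set.extremePoints ℝ (convexHull ℝ (L '' stabPoints k E))).ncard

/-- FIRST LEMMA (shadow transfer through a presentation; provable now from `stub_faceShadow`):
a presentation of `STAB(E)` by the pattern face `Z` bounds every shadow of `STAB(E)` by
`4·σ(DS_N)`. -/
theorem shadow_le_of_presentation {k N : ℕ} (E : Finset (Fin k × Fin k))
    (Z : Set (Fin N × Fin N)) (π : (Fin N × Fin N → ℝ) →ₗ[ℝ] (Fin k → ℝ))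
    (h₁ : π '' patternPoints N Z ⊆ convexHull ℝ (stabPoints k E))
    (h₂ : stabPoints k E ⊆ π '' patternPoints N Z)
    (L : (Fin k → ℝ) →ₗ[ℝ] (Fin 2 → ℝ)) :
    ∃ L' : (Fin N × Fin N → ℝ) →ₗ[ℝ] (Fin 2 → ℝ),
      (Set.extremePoints ℝ (convexHull ℝ (L '' stabPoints k E))).ncard ≤
        4 * Literature.Computability.AlgebraicComplexity.birkhoffShadowVertexCount L' := by
  -- conv (L∘π)(pattern) = L(conv stab) by h₁, h₂; then `stub_faceShadow N Z (L ∘ₗ π)`.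
  sorry

/-- GLUE (the line's composition; arithmetic `2^{n/C}/4 > 2^{(log₂ N + c)^c}` for
`log₂ N ≤ (3 log₂ n + d + 1)^d` and padding by `stub_facePad`). -/
theorem shadowBirkhoff_of_stabPresentation (hA : StCutShadowExp) (hB : StabPresentation) :
    Summit.ValiantsHypothesis.ValiantsHypothesis.Theses.DivisionGap.ShadowBirkhoff := by
  sorry

/-! ## The junk-free normal form (pendant choices) and its linear shadow (principal minors)

`PendantChoiceImage C D b b'`: in the bipartite core `C` with distinguished white pairs
`(b p, b' p)`, the 0/1 vectors `x` such that deleting the whites `{b p | x p = 1} ∪ {b' p | x p = 0}`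
leaves a perfectly matchable graph.  Adding a pendant black `a_p ~ {b_p, b'_p}` makes this EXACTLY the
image of the Birkhoff pattern face under `x_p := [a_p b_p ∈ M]` (no junk).  The presentation task is
`PendantChoiceImage = stable sets`.  Linear necessary condition (the core's gammoid is ℝ-linear):
a real `k × k` matrix whose non-vanishing principal minors are exactly the stable sets. -/

/-- Principal-minor presentability of the stable-set complex of `E` in dimension `k`. -/
def PMPresentable {k : ℕ} (E : Finset (Fin k × Fin k)) : Prop :=
  ∃ A : Matrix (Fin k) (Fin k) ℝ, ∀ S : Finset (Fin k),
    (A.submatrix (fun i : S => (i : Fin k)) (fun i : S => (i : Fin k))).det ≠ 0 ↔ IsStable E S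

/-- Hand-certified instance (this session, exact arithmetic `verify_hand.py`): the 4-cycle `K_{2,2}`
(vertices `0,1 | 2,3`) is PM-presentable by the rank-2 matrix with columns `v₁ v₂ v₁ v₂`,
`v₁ = (1,1,1,1)`, `v₂ = (1,2,2,1)` (Plücker `p₁₄ = p₂₃ = 0 ≠ p₁₂ p₃₄`). Stated, not re-proved here. -/
def c4Matrix : Matrix (Fin 4) (Fin 4) ℝ := !![1, 1, 1, 1; 1, 2, 1, 2; 1, 2, 1, 2; 1, 1, 1, 1]

end Summit.ValiantsHypothesis.ValiantsHypothesis.Cruxes.ShadowBirkhoff.Ideator5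

end
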